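import Summits.BirchSwinnertonDyer.BirchSwinnertonDyer.Theorems.ThetaPartnerAtTwoSignedKatoUpToAtTwoPointsSemilinear
import Literature.NumberTheory.EllipticCurves.Sprung2012.LocalIwasawaModule
import HarnessLib

/-!
# Route `ThetaPartnerAtTwo` (TP2), crux K3 `SignedKatoDivisibilityUpToAtTwo` (item stmt-BirchSwinnertonDyer-20308),
# line `colemanrat` v5 — **the points-model `j` is `ι`-SEMILINEAR for the whole of `Λ`**: with the `Λ`-module structure
# `Sprung2012.moduleOfGenerator` (`lambdaSMul`, `T ↦ (· ∘ g⁻¹) − id`) on the functionals on `E(ℚ_∞·ℚ_v)`,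
# `j ((f • z)|_A) = ι(f) • j (z|_A)` for EVERY `f ∈ Λ = ℤ₂⟦T⟧`, `ι = IwasawaAlgebra.invol` — the clause
# `∀ g y, j (g • y) = ι(g) • j y` of the registered stub `stub_localRobustPackageTwoInv` (R2^ι) for the points model.

Lead `bsd-wall-tp2-p2x` g4 (cell `bsd-wall`). HONEST FRAMING: THEOREMS ONLY — no definition, no named fact, no instance, no `sorry`;
closes no item; BSD is NOT proved by any of this. Inputs: `…PointsSemilinear` (the `T`-instance), `Sprung2012/LocalIwasawaModule`
(`lambdaSMul_*`), `SignedSelmerDualData.toDual_{T,C}_smul`, `WeierstrassCurve.exists_conjH1_pow_prime_pow_eq`, `IwasawaDual.zpT_mul`.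

## What is proved
* §1 (any pinned `D`, any `K`) `toDual_one_add_X_pow_smul` — `D.toDual ((1+T)^N • y) s = D.toDual y (conj_{γ^N} s)`;
  `toDual_smul_eq_zero_of_omega_dvd` — `ω_m ∣ f` and `conj_{γ^{p^m}} s = s` ⟹ `D.toDual (f • y) s = 0`;
  `invol_omega_eq` — `ι(ω_m) = −ι(1+T)^{p^m}·ω_m`; `toDual_invol_smul_congr` — `ω_m ∣ f − r` ⟹ `D.toDual (ι f • y) s = D.toDual (ι r • y) s`.
* §2 (`K = ℚ`) `pointsModelJ_padicInt_smul` — `j (a • φ_A) = C a • j φ_A`; `pointsModelJ_lambdaSMul_coe` — polynomials;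
  **`pointsModelJ_lambdaSMul`** — `j ((lambdaSMul κ ι W hg f z)|_A) = IwasawaAlgebra.invol p f • j (z|_A)` for all `f ∈ Λ`.

References: [Kobayashi2003] §8.5 (p. 18); [Sprung2012] §2 p. 1486, Def. 5.9; [GreenbergLNM1716] §1 p. 60; [Washington1997] §7.1, §13.2.
-/

set_option autoImplicit false
-- the Theorems namespace of this sub repeats the summit name by design (D-0017 nested layout)
set_option linter.dupNamespace false

noncomputable section

open scoped Classical

namespace Summit.BirchSwinnertonDyer.BirchSwinnertonDyer.Theorems

namespace SignedKatoOffTwo.KummerPoint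

open NumberField IsDedekindDomain Field WeierstrassCurve Polynomial
  Literature.NumberTheory.EllipticCurves Literature.NumberTheory.EllipticCurves.Kobayashi2003
  Literature.NumberTheory.EllipticCurves.Sprung2012 Literature.NumberTheory.GaloisRepresentations ZpExtension
  Literature.NumberTheory.EllipticCurves.Sprung2017

universe u

/-! ## §1 Power series divisible by `ω_m` act trivially against a class fixed by `γ^{p^m}` -/

section Dual

variable {K : Type u} [Field K] [NumberField K] {W : WeierstrassCurve K} {p : ℕ} [Fact p.Prime]
  {κ : ZpExtension K p} {γ : absoluteGaloisGroup K} {ε : ℤˣ} (D : SignedSelmerDualData W κ γ ε)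

/-- `conj_{γ^N} s ∈ Sel^ε_∞`. [cite: Kobayashi2003, Def. 1.1 (sentence following it, p. 2)] -/
theorem conjH1_pow_mem (N : ℕ) (s : signedSelmerInfty W κ ε) :
    W.conjH1 p κ.kerSubgroup (γ ^ N) (s : W.subgroupH1 p κ.kerSubgroup) ∈ signedSelmerInfty W κ ε :=
  conjH1_mem_signedSelmerInfty W κ ε _ s.2

/-- **`D.toDual ((1+T)^N • y) s = D.toDual y (conj_{γ^N} s)`** (`1 + T` acts as pre-composition with `conj_γ`).
[cite: Kobayashi2003, Def. 1.1 (sentence following it, p. 2)] [cite: GreenbergLNM1716, §1 p. 60] -/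
theorem toDual_one_add_X_pow_smul (N : ℕ) (y : D.X) (s : signedSelmerInfty W κ ε) :
    D.toDual ((1 + (PowerSeries.X : IwasawaAlgebra p)) ^ N • y) s =
      D.toDual y ⟨W.conjH1 p κ.kerSubgroup (γ ^ N) (s : W.subgroupH1 p κ.kerSubgroup), conjH1_pow_mem N s⟩ := by
  induction N generalizing s with
  | zero =>
    have e : (⟨W.conjH1 p κ.kerSubgroup (γ ^ 0) (s : W.subgroupH1 p κ.kerSubgroup), conjH1_pow_mem 0 s⟩ :
        signedSelmerInfty W κ ε) = s :=
      Subtype.ext (by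
        change W.conjH1 p κ.kerSubgroup (γ ^ 0) (s : W.subgroupH1 p κ.kerSubgroup) = s
        rw [pow_zero, W.conjH1_one_holds p κ.kerSubgroup, AddMonoidHom.id_apply])
    rw [pow_zero, one_smul, e]
  | succ N ih =>
    have e : (⟨W.conjH1 p κ.kerSubgroup (γ ^ N)
          ((⟨W.conjH1 p κ.kerSubgroup γ s, D.conj_mem s s.2⟩ : signedSelmerInfty W κ ε) : W.subgroupH1 p κ.kerSubgroup),
          conjH1_pow_mem N _⟩ : signedSelmerInfty W κ ε) =
        ⟨W.conjH1 p κ.kerSubgroup (γ ^ (N + 1)) (s : W.subgroupH1 p κ.kerSubgroup), conjH1_pow_mem (N + 1) s⟩ :=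
      Subtype.ext (by
        change W.conjH1 p κ.kerSubgroup (γ ^ N) (W.conjH1 p κ.kerSubgroup γ s) = W.conjH1 p κ.kerSubgroup (γ ^ (N + 1)) s
        rw [pow_succ, W.conjH1_mul_holds p κ.kerSubgroup, AddMonoidHom.comp_apply])
    rw [pow_succ', mul_smul, add_smul, one_smul, map_add, AddMonoidHom.add_apply, D.toDual_T_smul, add_sub_cancel, ih, e]

/-- `ω_m = (1+T)^{p^m} − 1` in `Λ`. [cite: Washington1997, §7.1] -/
theorem toIwasawa_cyclotomicOmega_eq (m : ℕ) :
    toIwasawa p (cyclotomicOmega p m) = (1 + (PowerSeries.X : IwasawaAlgebra p)) ^ p ^ m - 1 := by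
  rw [toIwasawa_cyclotomicOmega_eq_coe, Polynomial.coe_sub, Polynomial.coe_pow, Polynomial.coe_add, Polynomial.coe_X,
    Polynomial.coe_one, add_comm]

/-- **`ω_m` acts trivially against a class fixed by `γ^{p^m}`**: if `ω_m ∣ f` and `conj_{γ^{p^m}} s = s` then `D.toDual (f • y) s = 0`.
[cite: Kobayashi2003, Def. 1.1 (sentence following it, p. 2)] [cite: Washington1997, §13.2] -/
theorem toDual_smul_eq_zero_of_omega_dvd {m : ℕ} {f : IwasawaAlgebra p} (hf : toIwasawa p (cyclotomicOmega p m) ∣ f) (y : D.X)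
    {s : signedSelmerInfty W κ ε} (hs : W.conjH1 p κ.kerSubgroup (γ ^ p ^ m) (s : W.subgroupH1 p κ.kerSubgroup) = s) :
    D.toDual (f • y) s = 0 := by
  obtain ⟨h, rfl⟩ := hf
  rw [mul_smul, toIwasawa_cyclotomicOmega_eq, sub_smul, one_smul, map_sub, AddMonoidHom.sub_apply,
    toDual_one_add_X_pow_smul, sub_eq_zero]
  congr 1
  exact Subtype.ext hs

/-- `ι(1+T)^N · (1+T)^N = 1`. [cite: MazurTateTeitelbaum1986Invent, Ch. I §17] -/
theorem invol_one_add_X_pow_mul (N : ℕ) :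
    IwasawaAlgebra.invol p (1 + PowerSeries.X) ^ N * (1 + (PowerSeries.X : IwasawaAlgebra p)) ^ N = 1 := by
  rw [← mul_pow, mul_comm, IwasawaAlgebra.one_add_X_mul_invol_one_add_X, one_pow]

/-- **`ι(ω_m) = −ι(1+T)^{p^m} · ω_m`**: the involution maps `ω_m` to a unit multiple of itself. [cite: MazurTateTeitelbaum1986Invent, Ch. I §17] -/
theorem invol_omega_eq (m : ℕ) :
    IwasawaAlgebra.invol p (toIwasawa p (cyclotomicOmega p m)) =
      -(IwasawaAlgebra.invol p (1 + PowerSeries.X) ^ p ^ m) * toIwasawa p (cyclotomicOmega p m) := by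
  rw [toIwasawa_cyclotomicOmega_eq, map_sub, map_one, map_pow]
  linear_combination invol_one_add_X_pow_mul (p := p) (p ^ m)

/-- **Congruent power series act alike after `ι`**: `ω_m ∣ f − r` and `conj_{γ^{p^m}} s = s` ⟹ `D.toDual (ι f • y) s = D.toDual (ι r • y) s`.
[cite: Washington1997, §13.2] [cite: MazurTateTeitelbaum1986Invent, Ch. I §17] -/
theorem toDual_invol_smul_congr {m : ℕ} {f r : IwasawaAlgebra p} (hfr : toIwasawa p (cyclotomicOmega p m) ∣ f - r) (y : D.X)
    {s : signedSelmerInfty W κ ε} (hs : W.conjH1 p κ.kerSubgroup (γ ^ p ^ m) (s : W.subgroupH1 p κ.kerSubgroup) = s) :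
    D.toDual (IwasawaAlgebra.invol p f • y) s = D.toDual (IwasawaAlgebra.invol p r • y) s := by
  rw [← sub_eq_zero, ← AddMonoidHom.sub_apply, ← map_sub, ← sub_smul, ← map_sub]
  refine toDual_smul_eq_zero_of_omega_dvd D ?_ y hs
  obtain ⟨h, hh⟩ := hfr
  rw [hh, map_mul, invol_omega_eq]
  exact ⟨-(IwasawaAlgebra.invol p (1 + PowerSeries.X) ^ p ^ m) * IwasawaAlgebra.invol p h, by ring⟩

omit [NumberField K] in
/-- If `conj_τ s = s` then `conj_{τ^N} s = s`. [cite: SerreGaloisCohomology1997, I §5.1] -/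
theorem conjH1_pow_eq_self_of_eq {τ : absoluteGaloisGroup K} {s : W.subgroupH1 p κ.kerSubgroup}
    (h : W.conjH1 p κ.kerSubgroup τ s = s) (N : ℕ) : W.conjH1 p κ.kerSubgroup (τ ^ N) s = s := by
  induction N with
  | zero => rw [pow_zero, W.conjH1_one_holds p κ.kerSubgroup, AddMonoidHom.id_apply]
  | succ N ih => rw [pow_succ, W.conjH1_mul_holds p κ.kerSubgroup, AddMonoidHom.comp_apply, h, ih]

/-- Every class of `H¹(K_∞, E[p^∞])` is fixed by `conj_{γ^{p^m}}` for all large `m` (`γ` a topological generator).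
[cite: Kobayashi2003, Def. 1.1 (sentence following it, p. 2)] -/
theorem exists_forall_le_conjH1_pow_eq (hγ : κ.IsTopGenerator γ) (s : W.subgroupH1 p κ.kerSubgroup) :
    ∃ a : ℕ, ∀ m, a ≤ m → W.conjH1 p κ.kerSubgroup (γ ^ p ^ m) s = s := by
  obtain ⟨a, ha⟩ := W.exists_conjH1_pow_prime_pow_eq κ hγ s
  refine ⟨a, fun m hm ↦ ?_⟩
  obtain ⟨d, rfl⟩ := Nat.exists_eq_add_of_le hm
  rw [pow_add, pow_mul]
  exact conjH1_pow_eq_self_of_eq ha _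

end Dual

/-! ## §2 `K = ℚ`: `j (f • z|_A) = ι(f) • j (z|_A)` for every `f ∈ Λ` -/

section Rat

variable (W : WeierstrassCurve ℚ) {p : ℕ} [Fact p.Prime] (κ : ZpExtension ℚ p) {γ : absoluteGaloisGroup ℚ} (ε : ℤˣ)

/-- **`j (a • φ_A) = C a • j φ_A`** for `a ∈ ℤ_p` (value formula + `toDual_C_smul` at a common exponent, `IwasawaDual.zpT_mul`).
[cite: Kobayashi2003, §8.5 (p. 18)] -/
theorem pointsModelJ_padicInt_smul (v : HeightOneSpectrum (𝓞 ℚ)) (hv : (p : 𝓞 ℚ) ∈ v.asIdeal)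
    (D : SignedSelmerDualData W κ γ ε)
    (j : (↥(⨆ n, signedLocalPoints κ (v.adicCompletion ℚ) W ε n) →+ ℤ_[p]) →+ D.X)
    (hj : ∀ (φA : ↥(⨆ n, signedLocalPoints κ (v.adicCompletion ℚ) W ε n) →+ ℤ_[p])
        (s : W.subgroupH1 p κ.kerSubgroup) (hs : s ∈ signedSelmerInfty W κ ε)
        (φ : contOneCocycles (discreteTopRep κ.kerSubgroup (W.geomPrimaryTorsion p)))
        (Q : localPoints W (v.adicCompletion ℚ)) (k : ℕ)
        (_ : oneCocycleClass _ φ = s) (hQ : p ^ k • Q ∈ (⨆ n, signedLocalPoints κ (v.adicCompletion ℚ) W ε n))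
        (_ : ∀ τ : localSubgroupOfEmb κ.kerSubgroup (closureEmb (K := ℚ) (v.adicCompletion ℚ)),
          pointsMapOfEmb W (closureEmb (K := ℚ) (v.adicCompletion ℚ))
              ((φ.1 (resGalSubgroupOfEmb κ.kerSubgroup _ τ) : W.geomPrimaryTorsion p) : W.geomPoints) =
            (τ : absoluteGaloisGroup (v.adicCompletion ℚ)) • Q - Q),
        D.toDual (j φA) ⟨s, hs⟩ =
          (PadicInt.toZModPow k (φA ⟨p ^ k • Q, hQ⟩)).val • ((((p : ℚ) ^ k)⁻¹ : ℚ) : AddCircle (1 : ℚ)))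
    (a : ℤ_[p]) (φA : ↥(⨆ n, signedLocalPoints κ (v.adicCompletion ℚ) W ε n) →+ ℤ_[p]) :
    j (a • φA) = (PowerSeries.C a : IwasawaAlgebra p) • j φA := by
  apply D.bijective.1
  ext ⟨s, hs⟩
  have hs' := SignedEC.signedSelmerInfty_le_localKummerOverOfEmb_iSup_signedLocalPoints W κ ε v hv hs
  obtain ⟨φ, Q, k, hφ, hQ, hτ⟩ := (mem_localKummerOverOfEmb_iff _ s).1 hs'
  obtain ⟨k₀, hk₀⟩ := W.exists_pow_smul_subgroupH1_ker_eq_zero κ s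
  -- common exponent `N = k + k₀`
  have hQN : p ^ (k + k₀) • Q ∈ (⨆ n, signedLocalPoints κ (v.adicCompletion ℚ) W ε n) := by
    rw [pow_add, mul_comm, mul_smul]; exact AddSubgroup.nsmul_mem _ hQ _
  have hsN : p ^ (k + k₀) • (⟨s, hs⟩ : signedSelmerInfty W κ ε) = 0 := by
    apply Subtype.ext
    rw [AddSubgroupClass.coe_nsmul, pow_add, mul_smul, hk₀, smul_zero, ZeroMemClass.coe_zero]
  have hx0 : p ^ (k + k₀) • ((((p : ℚ) ^ (k + k₀))⁻¹ : ℚ) : AddCircle (1 : ℚ)) = 0 := pow_nsmul_invPow_self p _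
  rw [hj _ s hs φ Q (k + k₀) hφ hQN hτ, D.toDual_C_smul a _ _ (k + k₀) hsN, hj _ s hs φ Q (k + k₀) hφ hQN hτ,
    AddMonoidHom.smul_apply, smul_eq_mul]
  exact IwasawaDual.zpT_mul hx0 a _

/-- **Polynomials**: `j ((r • z)|_A) = ι(r) • j (z|_A)` for `r ∈ ℤ_p[T]` (induction: constants by `pointsModelJ_padicInt_smul` +
`lambdaSMul_C`, the step `T` by `pointsModelJ_twist_sub` + `lambdaSMul_X_apply`). [cite: Sprung2012, §2 p. 1486, Def. 5.9]
[cite: GreenbergLNM1716, §1 p. 60] -/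
theorem pointsModelJ_lambdaSMul_coe (v : HeightOneSpectrum (𝓞 ℚ)) (hv : (p : 𝓞 ℚ) ∈ v.asIdeal)
    {g : absoluteGaloisGroup (v.adicCompletion ℚ)} (hg : κ.IsTopGenerator (resGalOfEmb (closureEmb (K := ℚ) (v.adicCompletion ℚ)) g))
    (hσ : κ γ = κ (resGalOfEmb (closureEmb (K := ℚ) (v.adicCompletion ℚ)) g))
    (hA : ∀ a ∈ (⨆ n, signedLocalPoints κ (v.adicCompletion ℚ) W ε n), g • a ∈ (⨆ n, signedLocalPoints κ (v.adicCompletion ℚ) W ε n))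
    (D : SignedSelmerDualData W κ γ ε)
    (j : (↥(⨆ n, signedLocalPoints κ (v.adicCompletion ℚ) W ε n) →+ ℤ_[p]) →+ D.X)
    (hj : ∀ (φA : ↥(⨆ n, signedLocalPoints κ (v.adicCompletion ℚ) W ε n) →+ ℤ_[p])
        (s : W.subgroupH1 p κ.kerSubgroup) (hs : s ∈ signedSelmerInfty W κ ε)
        (φ : contOneCocycles (discreteTopRep κ.kerSubgroup (W.geomPrimaryTorsion p)))
        (Q : localPoints W (v.adicCompletion ℚ)) (k : ℕ)
        (_ : oneCocycleClass _ φ = s) (hQ : p ^ k • Q ∈ (⨆ n, signedLocalPoints κ (v.adicCompletion ℚ) W ε n))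
        (_ : ∀ τ : localSubgroupOfEmb κ.kerSubgroup (closureEmb (K := ℚ) (v.adicCompletion ℚ)),
          pointsMapOfEmb W (closureEmb (K := ℚ) (v.adicCompletion ℚ))
              ((φ.1 (resGalSubgroupOfEmb κ.kerSubgroup _ τ) : W.geomPrimaryTorsion p) : W.geomPoints) =
            (τ : absoluteGaloisGroup (v.adicCompletion ℚ)) • Q - Q),
        D.toDual (j φA) ⟨s, hs⟩ =
          (PadicInt.toZModPow k (φA ⟨p ^ k • Q, hQ⟩)).val • ((((p : ℚ) ^ k)⁻¹ : ℚ) : AddCircle (1 : ℚ)))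
    (hle : (⨆ n, signedLocalPoints κ (v.adicCompletion ℚ) W ε n) ≤ localTowerPointsOfEmb κ (closureEmb (K := ℚ) (v.adicCompletion ℚ)) W)
    (r : ℤ_[p][X]) (z : localTowerPointsOfEmb κ (closureEmb (K := ℚ) (v.adicCompletion ℚ)) W →+ ℤ_[p]) :
    j ((lambdaSMul κ (closureEmb (K := ℚ) (v.adicCompletion ℚ)) W hg (r : PowerSeries ℤ_[p]) z).comp (AddSubgroup.inclusion hle)) =
      IwasawaAlgebra.invol p (r : PowerSeries ℤ_[p]) • j (z.comp (AddSubgroup.inclusion hle)) := by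
  induction r using Polynomial.induction_on generalizing z with
  | C a =>
    rw [Polynomial.coe_C, lambdaSMul_C, IwasawaAlgebra.invol_C, ← pointsModelJ_padicInt_smul W κ ε v hv D j hj a]
    rfl
  | add r r' hr hr' =>
    rw [Polynomial.coe_add, add_lambdaSMul, AddMonoidHom.add_comp, map_add, hr, hr', map_add, add_smul]
  | monomial k a ih =>
    have e : ((C a * X ^ (k + 1) : ℤ_[p][X]) : PowerSeries ℤ_[p]) = ((C a * X ^ k : ℤ_[p][X]) : PowerSeries ℤ_[p]) * PowerSeries.X := by
      rw [pow_succ, ← mul_assoc, Polynomial.coe_mul, Polynomial.coe_X]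
    rw [e, mul_lambdaSMul, ih, map_mul, mul_smul]
    -- the `T`-step on the functional `X • z = z ∘ g⁻¹ − z`
    congr 1
    obtain ⟨w, hw⟩ := exists_twist κ (closureEmb (K := ℚ) (v.adicCompletion ℚ)) W g z
    have hz'w : lambdaSMul κ (closureEmb (K := ℚ) (v.adicCompletion ℚ)) W hg (PowerSeries.X : IwasawaAlgebra p) z = w - z := by
      ext y
      rw [lambdaSMul_X_apply, AddMonoidHom.sub_apply, hw]
    rw [hz'w, AddMonoidHom.sub_comp, map_sub]
    exact pointsModelJ_twist_sub W κ ε v hv g hσ hA D j hj hle hw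

/-- **The points-model `j` is `ι`-semilinear on all of `Λ`**: `j ((f • z)|_A) = ι(f) • j (z|_A)` for every `f ∈ Λ`, `f • z = lambdaSMul … hg f z`
(`Sprung2012.moduleOfGenerator`), `ι = IwasawaAlgebra.invol p`. Proof: on each Selmer class `s` both sides see `f` only modulo `ω_m` for `m`
large (`lambdaSMul_apply_eq_aeval` on the Kummer witness point; `toDual_invol_smul_congr` on `D.X`), so the polynomial case suffices.
[cite: Sprung2012, §2 p. 1486 and Def. 5.9 (p. 1495)] [cite: GreenbergLNM1716, §1 p. 60] [cite: MazurTateTeitelbaum1986Invent, Ch. I §17] -/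
theorem pointsModelJ_lambdaSMul (v : HeightOneSpectrum (𝓞 ℚ)) (hv : (p : 𝓞 ℚ) ∈ v.asIdeal) (hγ : κ.IsTopGenerator γ)
    {g : absoluteGaloisGroup (v.adicCompletion ℚ)} (hg : κ.IsTopGenerator (resGalOfEmb (closureEmb (K := ℚ) (v.adicCompletion ℚ)) g))
    (hA : ∀ a ∈ (⨆ n, signedLocalPoints κ (v.adicCompletion ℚ) W ε n), g • a ∈ (⨆ n, signedLocalPoints κ (v.adicCompletion ℚ) W ε n))
    (D : SignedSelmerDualData W κ γ ε)
    (j : (↥(⨆ n, signedLocalPoints κ (v.adicCompletion ℚ) W ε n) →+ ℤ_[p]) →+ D.X)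
    (hj : ∀ (φA : ↥(⨆ n, signedLocalPoints κ (v.adicCompletion ℚ) W ε n) →+ ℤ_[p])
        (s : W.subgroupH1 p κ.kerSubgroup) (hs : s ∈ signedSelmerInfty W κ ε)
        (φ : contOneCocycles (discreteTopRep κ.kerSubgroup (W.geomPrimaryTorsion p)))
        (Q : localPoints W (v.adicCompletion ℚ)) (k : ℕ)
        (_ : oneCocycleClass _ φ = s) (hQ : p ^ k • Q ∈ (⨆ n, signedLocalPoints κ (v.adicCompletion ℚ) W ε n))
        (_ : ∀ τ : localSubgroupOfEmb κ.kerSubgroup (closureEmb (K := ℚ) (v.adicCompletion ℚ)),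
          pointsMapOfEmb W (closureEmb (K := ℚ) (v.adicCompletion ℚ))
              ((φ.1 (resGalSubgroupOfEmb κ.kerSubgroup _ τ) : W.geomPrimaryTorsion p) : W.geomPoints) =
            (τ : absoluteGaloisGroup (v.adicCompletion ℚ)) • Q - Q),
        D.toDual (j φA) ⟨s, hs⟩ =
          (PadicInt.toZModPow k (φA ⟨p ^ k • Q, hQ⟩)).val • ((((p : ℚ) ^ k)⁻¹ : ℚ) : AddCircle (1 : ℚ)))
    (hle : (⨆ n, signedLocalPoints κ (v.adicCompletion ℚ) W ε n) ≤ localTowerPointsOfEmb κ (closureEmb (K := ℚ) (v.adicCompletion ℚ)) W)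
    (f : IwasawaAlgebra p) (z : localTowerPointsOfEmb κ (closureEmb (K := ℚ) (v.adicCompletion ℚ)) W →+ ℤ_[p]) :
    j ((lambdaSMul κ (closureEmb (K := ℚ) (v.adicCompletion ℚ)) W hg f z).comp (AddSubgroup.inclusion hle)) =
      IwasawaAlgebra.invol p f • j (z.comp (AddSubgroup.inclusion hle)) := by
  have hσ : κ γ = κ (resGalOfEmb (closureEmb (K := ℚ) (v.adicCompletion ℚ)) g) := by
    rw [ZpExtension.IsTopGenerator] at hγ hg; rw [hγ, hg]
  apply D.bijective.1
  ext ⟨s, hs⟩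
  have hs' := SignedEC.signedSelmerInfty_le_localKummerOverOfEmb_iSup_signedLocalPoints W κ ε v hv hs
  obtain ⟨φ, Q, k, hφ, hQ, hτ⟩ := (mem_localKummerOverOfEmb_iff _ s).1 hs'
  -- a level `m` with `p^k Q ∈ E(ℚ_m·ℚ_v)` and `conj_{γ^{p^m}} s = s`
  obtain ⟨n₀, hn₀⟩ := exists_mem_localLayerPointsOfEmb_of_mem_localTowerPointsOfEmb κ
    (closureEmb (K := ℚ) (v.adicCompletion ℚ)) W (hle hQ)
  obtain ⟨a, ha⟩ := exists_forall_le_conjH1_pow_eq (W := W) hγ s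
  have hQm : p ^ k • Q ∈ localLayerPointsOfEmb κ (closureEmb (K := ℚ) (v.adicCompletion ℚ)) W (max n₀ a) :=
    localLayerPointsOfEmb_mono κ _ W (le_max_left _ _) hn₀
  have hsm : W.conjH1 p κ.kerSubgroup (γ ^ p ^ (max n₀ a)) s = s := ha _ (le_max_right _ _)
  -- a polynomial representative modulo `ω_m`
  have hfr := toIwasawa_dvd_sub_polyRep (max n₀ a) f
  -- the value of `f • z` at `p^k Q` is that of `r • z`
  have hval : (lambdaSMul κ (closureEmb (K := ℚ) (v.adicCompletion ℚ)) W hg f z).comp (AddSubgroup.inclusion hle) ⟨p ^ k • Q, hQ⟩ =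
      (lambdaSMul κ (closureEmb (K := ℚ) (v.adicCompletion ℚ)) W hg (polyRep p (max n₀ a) f : PowerSeries ℤ_[p]) z).comp
        (AddSubgroup.inclusion hle) ⟨p ^ k • Q, hQ⟩ := by
    rw [AddMonoidHom.comp_apply, AddMonoidHom.comp_apply]
    change lambdaSMul κ _ W hg f z ⟨p ^ k • Q, hle hQ⟩ = lambdaSMul κ _ W hg (polyRep p (max n₀ a) f : PowerSeries ℤ_[p]) z ⟨p ^ k • Q, hle hQ⟩
    rw [lambdaSMul_apply_eq_aeval hg f z hfr hQm, lambdaSMul_coe_polynomial hg _ z]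
  have e1 := hj ((lambdaSMul κ (closureEmb (K := ℚ) (v.adicCompletion ℚ)) W hg f z).comp (AddSubgroup.inclusion hle)) s hs φ Q k hφ hQ hτ
  have e2 := hj ((lambdaSMul κ (closureEmb (K := ℚ) (v.adicCompletion ℚ)) W hg (polyRep p (max n₀ a) f : PowerSeries ℤ_[p]) z).comp
    (AddSubgroup.inclusion hle)) s hs φ Q k hφ hQ hτ
  have e4 := pointsModelJ_lambdaSMul_coe W κ ε v hv hg hσ hA D j hj hle (polyRep p (max n₀ a) f) z
  rw [e1, hval, ← e2, e4]
  exact (toDual_invol_smul_congr D hfr _ hsm).symm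

end Rat

end SignedKatoOffTwo.KummerPoint

end Summit.BirchSwinnertonDyer.BirchSwinnertonDyer.Theorems

end
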